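import Mathlib
import Summits.Ventures.HodgeRepro2.T5OneCovectorWedge
import Summits.Ventures.HodgeRepro2.T5L2Positivity

/-!
# Theorem 6.32 at `k = 1`, global form: `∫_S i ω ∧ α ∧ ᾱ > 0` for a non-zero `(1,0)`-form

Tier-5 support for sub-step N1 (Hodge-theoretic side, route/T5-N1-hodge-p6.md §H3).
`T5OneCovectorWedge` proves Voisin's Theorem 6.32 [Hodge Theory I, p0128 l. 35] at `k = 1`
pointwise in the coframe model of a surface: `H₁(α, α) = i ∫ ω ∧ α ∧ ᾱ` has the pointwise
density `2 Σ_k |a_k|²` on a `(1,0)`-covector `α = Σ a_k dz_k`.  This file integrates it over a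
compact `S` against the volume measure, exactly as `T5TwoZeroPositivity` (row 30) and
`T5OneOneNegativity` (row 51) do at `k = 2`: for a continuous coefficient field
`a : S → Fin 2 → ℂ`,

* `∫_S H₁(α_s, α_s) = 2 ∫_S Σ_k |a_k(s)|² dVol` (real, `≥ 0`),
* `= 0 ↔ a = 0` and `> 0 ↔ a ≠ 0` (`S` compact, `Vol` finite on compacts and positive on
  non-empty open sets, the coefficients continuous — the hypotheses of row 27),
* the `(0,1)` side with the opposite sign, and the global orthogonality of the two types.

Model level: the manifold, the bundle-versus-trivialisation bookkeeping and Voisin's (5.1) as the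
definition of the `L²` product stay prose (memo §H2.2).
-/

namespace Summit.Ventures.HodgeRepro2.T5OneZeroPositivityGlobal

open Complex MeasureTheory T5OneCovectorNormalisation T5OneCovectorWedge T5L2Positivity

variable {S : Type*} [MeasurableSpace S] {μ : Measure S}

/-- The pointwise density `Σ_k |a_k(s)|²` of a `(1,0)`-coefficient field `a`. -/
def density1 (a : S → Fin 2 → ℂ) (s : S) : ℝ := ∑ k, Complex.normSq (a s k)

omit [MeasurableSpace S] in
/-- The density is non-negative. -/
theorem density1_nonneg (a : S → Fin 2 → ℂ) : 0 ≤ density1 a :=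
  fun _ => Finset.sum_nonneg (fun _ _ => Complex.normSq_nonneg _)

omit [MeasurableSpace S] in
/-- The density of a continuous field is continuous. -/
theorem continuous_density1 [TopologicalSpace S] {a : S → Fin 2 → ℂ} (ha : Continuous a) :
    Continuous (density1 a) :=
  continuous_finsetSum _ (fun k _ => Complex.continuous_normSq.comp ((continuous_apply k).comp ha))

omit [MeasurableSpace S] in
/-- The density vanishes identically iff the field does. -/
theorem density1_eq_zero_iff (a : S → Fin 2 → ℂ) : density1 a = 0 ↔ a = 0 := by
  constructor
  · intro h
    ext s k
    have hs : density1 a s = 0 := by rw [h]; rfl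
    simp only [density1] at hs
    rw [Finset.sum_eq_zero_iff_of_nonneg (fun k _ => Complex.normSq_nonneg (a s k))] at hs
    simpa using hs k (Finset.mem_univ k)
  · rintro rfl; ext s; simp [density1]

omit [MeasurableSpace S] in
/-- `H₁(α, α) = 2 Σ_k |a_k|²` pointwise, as a real number cast to `ℂ`. -/
theorem H1_oneZero_self_eq_density (a : S → Fin 2 → ℂ) (s : S) :
    H1 (oneZero (a s)) (oneZero (a s)) = ((2 * density1 a s : ℝ) : ℂ) := by
  rw [H1_oneZero_oneZero, h10_self]; simp [density1]

/-- **The global form**: `∫_S H₁(α, α) dVol = 2 ∫_S Σ_k |a_k|² dVol` (no integrability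
hypothesis is needed for the identity: both sides are `0` if the density is not integrable). -/
theorem integral_H1_oneZero_self (a : S → Fin 2 → ℂ) :
    ∫ s, H1 (oneZero (a s)) (oneZero (a s)) ∂μ = ((2 * ∫ s, density1 a s ∂μ : ℝ) : ℂ) := by
  simp_rw [H1_oneZero_self_eq_density]
  rw [show (∫ s, ((2 * density1 a s : ℝ) : ℂ) ∂μ) = ((∫ s, 2 * density1 a s ∂μ : ℝ) : ℂ) from
    integral_ofReal, integral_const_mul]

/-- The global `H₁`-norm of a `(1,0)`-form is real. -/
theorem integral_H1_oneZero_self_im (a : S → Fin 2 → ℂ) :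
    (∫ s, H1 (oneZero (a s)) (oneZero (a s)) ∂μ).im = 0 := by
  rw [integral_H1_oneZero_self]; simp

/-- The global `H₁`-norm of a `(1,0)`-form is non-negative. -/
theorem integral_H1_oneZero_self_re_nonneg (a : S → Fin 2 → ℂ) :
    0 ≤ (∫ s, H1 (oneZero (a s)) (oneZero (a s)) ∂μ).re := by
  rw [integral_H1_oneZero_self]
  simp only [ofReal_re]
  exact mul_nonneg (by norm_num) (integral_nonneg (density1_nonneg a))

section Compact

variable [TopologicalSpace S] [OpensMeasurableSpace S] [CompactSpace S]
  [IsFiniteMeasureOnCompacts μ] [μ.IsOpenPosMeasure]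

/-- **Theorem 6.32 at `(1,0)`, global, equality case**: for a continuous `(1,0)`-form `α` on
the compact `S`, `∫_S H₁(α, α) = 0 ↔ α = 0`. -/
theorem integral_H1_oneZero_self_eq_zero_iff {a : S → Fin 2 → ℂ} (ha : Continuous a) :
    ∫ s, H1 (oneZero (a s)) (oneZero (a s)) ∂μ = 0 ↔ a = 0 := by
  rw [integral_H1_oneZero_self, ← density1_eq_zero_iff,
    ← integral_eq_zero_iff_of_continuous (μ := μ) (continuous_density1 ha) (density1_nonneg a)]
  constructor
  · intro h
    have h' : (2 * ∫ s, density1 a s ∂μ : ℝ) = 0 := by exact_mod_cast h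
    linarith [mul_eq_zero.mp h']
  · intro h; rw [h]; simp

/-- **Theorem 6.32 at `(1,0)`, global**: `∫_S H₁(α, α) > 0 ↔ α ≠ 0` — the positive
definiteness of `(−1)^{k(k−1)/2} i^{p−q−k} H₁ = H₁` on the `(1,0)`-forms of the compact
surface, in the model. -/
theorem integral_H1_oneZero_self_re_pos_iff {a : S → Fin 2 → ℂ} (ha : Continuous a) :
    0 < (∫ s, H1 (oneZero (a s)) (oneZero (a s)) ∂μ).re ↔ a ≠ 0 := by
  rw [integral_H1_oneZero_self, ofReal_re]
  have hpos := integral_pos_iff_of_continuous (μ := μ) (continuous_density1 ha) (density1_nonneg a)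
  constructor
  · intro h ha0
    rw [ha0] at h
    simp [density1] at h
  · intro h
    have : ∃ s, density1 a s ≠ 0 := by
      by_contra hcon
      push Not at hcon
      exact h ((density1_eq_zero_iff a).mp (funext hcon))
    linarith [hpos.mpr this]

/-- The printed form at `(p, q, k) = (1, 0, 1)`, global:
`(−1)^{k(k−1)/2} i^{p−q−k} · i ∫_S Q₁(α, ᾱ) > 0 ↔ α ≠ 0`. -/
theorem thm632_oneZero_global_pos_iff {a : S → Fin 2 → ℂ} (ha : Continuous a) :
    0 < ((-1) ^ (1 * (1 - 1) / 2) * I ^ ((1 : ℤ) - 0 - 1) *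
      (I ^ 1 * ∫ s, Q1 (oneZero (a s)) (conj1 (oneZero (a s))) ∂μ)).re ↔ a ≠ 0 := by
  have h := integral_H1_oneZero_self_re_pos_iff (μ := μ) ha
  simp only [H1] at h
  rw [integral_const_mul] at h
  simpa using h

end Compact

/-! ### The `(0,1)` side and the global orthogonality -/

omit [MeasurableSpace S] in
/-- `H₁(β, β) = −2 Σ_k |b_k|²` pointwise on a `(0,1)`-covector `β = Σ b_k dz̄_k`. -/
theorem H1_zeroOne_self_eq_density (b : S → Fin 2 → ℂ) (s : S) :
    H1 (zeroOne (b s)) (zeroOne (b s)) = -((2 * density1 b s : ℝ) : ℂ) := by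
  rw [H1_zeroOne_zeroOne]
  have : h01 (b s) (b s) = ((∑ k, Complex.normSq (b s k) : ℝ) : ℂ) := by
    simp [h01, Complex.mul_conj]
  rw [this]; simp [density1]

/-- `∫_S H₁(β, β) dVol = −2 ∫_S Σ_k |b_k|² dVol` on the `(0,1)`-forms. -/
theorem integral_H1_zeroOne_self (b : S → Fin 2 → ℂ) :
    ∫ s, H1 (zeroOne (b s)) (zeroOne (b s)) ∂μ = -((2 * ∫ s, density1 b s ∂μ : ℝ) : ℂ) := by
  simp_rw [H1_zeroOne_self_eq_density]
  rw [integral_neg, show (∫ s, ((2 * density1 b s : ℝ) : ℂ) ∂μ) =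
    ((∫ s, 2 * density1 b s ∂μ : ℝ) : ℂ) from integral_ofReal, integral_const_mul]

/-- **Theorem 6.32 at `(0,1)`, global**: `−∫_S H₁(β, β) > 0 ↔ β ≠ 0` (the sign
`(−1)^{k(k−1)/2} i^{p−q−k} = i^{−2} = −1`). -/
theorem neg_integral_H1_zeroOne_self_re_pos_iff [TopologicalSpace S] [OpensMeasurableSpace S]
    [CompactSpace S] [IsFiniteMeasureOnCompacts μ] [μ.IsOpenPosMeasure]
    {b : S → Fin 2 → ℂ} (hb : Continuous b) :
    0 < (-∫ s, H1 (zeroOne (b s)) (zeroOne (b s)) ∂μ).re ↔ b ≠ 0 := by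
  rw [integral_H1_zeroOne_self, neg_neg, ofReal_re]
  have hpos := integral_pos_iff_of_continuous (μ := μ) (continuous_density1 hb) (density1_nonneg b)
  constructor
  · intro h hb0
    rw [hb0] at h
    simp [density1] at h
  · intro h
    have : ∃ s, density1 b s ≠ 0 := by
      by_contra hcon
      push Not at hcon
      exact h ((density1_eq_zero_iff b).mp (funext hcon))
    linarith [hpos.mpr this]

/-- The global orthogonality of the types (Theorem 6.32, first clause, at `k = 1`, integrated):
`∫_S H₁(α, β) = 0` for a `(1,0)`-form `α` and a `(0,1)`-form `β`. -/
theorem integral_H1_oneZero_zeroOne (a b : S → Fin 2 → ℂ) :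
    ∫ s, H1 (oneZero (a s)) (zeroOne (b s)) ∂μ = 0 := by
  simp [H1_oneZero_zeroOne]

/-- `∫_S H₁(β, α) = 0` for a `(0,1)`-form `β` and a `(1,0)`-form `α`. -/
theorem integral_H1_zeroOne_oneZero (b a : S → Fin 2 → ℂ) :
    ∫ s, H1 (zeroOne (b s)) (oneZero (a s)) ∂μ = 0 := by
  simp [H1_zeroOne_oneZero]

end Summit.Ventures.HodgeRepro2.T5OneZeroPositivityGlobal
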